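import Literature.AlgebraicGeometry.HodgeTheory.GysinKernelSplit
import Literature.AlgebraicGeometry.HodgeTheory.SubschemeStrataClassVanishing
import Literature.AlgebraicGeometry.HodgeTheory.PullbackVanishingOnSmoothSubscheme
import Literature.AlgebraicGeometry.HodgeTheory.GysinKernelSplitBirationalTransfer
import Literature.AlgebraicGeometry.HodgeTheory.ComplexPointsLocallyContractible
import Literature.AlgebraicGeometry.Resolution.LogResolutionSmoothProjective
import Literature.AlgebraicTopology.SingularHomology.CohomologyVanishingNearUnion
import HarnessLib

/-!
# Deligne, *Théorie de Hodge III*, Prop. 8.2.7 / Cor. 8.2.8 — discharge of `Deligne1974_ker_pullback_eq_ker_pullback_resolution`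

Topic: `Literature/AlgebraicGeometry/HodgeTheory`. PROOF of the named fact
`Deligne1974_ker_pullback_eq_ker_pullback_resolution` (`GysinKernelSplit.lean`): for a smooth
projective complex `X`, morphisms `g_j : Y_j → X` from smooth projective `Y_j` and
`x' ∈ H^q(X(ℂ); ℂ)` with `g_j^* x' = 0` for all `j`, the class `x'` vanishes on an open
neighbourhood of `Z(ℂ)`, `Z = ⋃_j g_j(Y_j)`.

The proof is the direct (Kähler / `∂∂̄`) one, assembled from PROVED bricks of the tree, with no
mixed Hodge structures:

1. (`Z = X`) then `x' = 0`: `𝟙_X` maps into `⋃ g_j(Y_j)`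
   (`complexBetti_map_eq_zero_of_range_subset_iUnion`, Voisin I Lemma 7.28 + Hironaka).
2. (`Z ⊊ X`) Log resolution `σ : X' → X` of `Z` (Kollár 2007 Thm. 3.21 through the tree's proved
   order reduction; `exists_logResolution_isSmoothProjective`): `X'` smooth projective of the same
   dimension, `σ` birational and an isomorphism off `Z`, `σ⁻¹Z = ⋃ᵢ V(D_i)` with all strata
   `V(Σ_{i∈I} D_i)` smooth of dimension `n - |I|`.
3. `σ^* x'` dies on every `V(D_i)` (`complexBetti_map_eq_zero_of_smooth_closedSubscheme`: each
   component of `V(D_i)` is dominated by a smooth projective variety mapping through some `Y_j`).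
4. Hence `σ^* x'` vanishes near `⋃ V(D_i)(ℂ) = σ⁻¹Z(ℂ)` — the compact-Kähler heart
   (`exists_isOpen_map_subsetIncl_eq_zero_of_strata`: GAGA, `∂∂̄`-lemma and Hodge decomposition on
   the strata, Čech–germ descent; Deligne's weights replaced by types).
5. Transfer down the birational `σ` (degree one, projection formula; excision):
   `x'|_{Z(ℂ)} = 0` (`singularCohomology_map_eq_zero_of_map_preimage_eq_zero_of_isIso_restrict`).
6. Tautness of the triangulable `Z(ℂ) ⊆ X(ℂ)` (`exists_isOpen_map_eq_zero_of_isClosed`).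

## References

* P. Deligne, *Théorie de Hodge III*, Publ. Math. IHÉS 44 (1974), Prop. 8.2.7, Cor. 8.2.8.
* C. Voisin, *Hodge Theory and Complex Algebraic Geometry I* (2002), Lemma 7.28, Prop. 6.17.
* J. Kollár, *Lectures on Resolution of Singularities* (2007), Thm. 3.21, Thm. 3.27.
* P. Deligne, Ph. Griffiths, J. Morgan, D. Sullivan, *Real homotopy theory of Kähler manifolds*,
  Invent. Math. 29 (1975), §5 (the `dd^c`-lemma).
-/

noncomputable section

set_option backward.isDefEq.respectTransparency false

open CategoryTheory CategoryTheory.Limits AlgebraicGeometry TopologicalSpace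
open Literature.AlgebraicTopology.SingularHomology Literature.AlgebraicGeometry.Resolution

namespace Literature.AlgebraicGeometry.HodgeTheory

open Literature.AlgebraicGeometry.Motives

/-- **Deligne, Hodge III, Prop. 8.2.7 / Cor. 8.2.8 — DISCHARGE of the named fact
`Deligne1974_ker_pullback_eq_ker_pullback_resolution`** (see the module docstring for the
architecture of the proof). [cite: DeligneHodgeIII1974, Prop. 8.2.7 and Cor. 8.2.8]
[cite: VoisinHodgeI2002, Lemma 7.28] [cite: Kollar2007, Thm. 3.21] -/
theorem Deligne1974_ker_pullback_eq_ker_pullback_resolution_holds :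
    Deligne1974_ker_pullback_eq_ker_pullback_resolution := by
  intro n X hX ι _ m Y hY g q x' hx'
  classical
  -- instances on `X` and the `Y j`
  haveI : IsProper X.hom := hX.isProjectiveOver.isProper
  haveI : ∀ j, IsProper (Y j).hom := fun j ↦ (hY j).isProjectiveOver.isProper
  have hgproper : ∀ j, IsProper (g j).left := fun j ↦ by
    have h : IsProper ((g j).left ≫ X.hom) := by rw [Over.w (g j)]; infer_instance
    exact IsProper.of_comp (g j).left X.hom
  -- the closed set `Z = ⋃ g_j(Y_j)`
  set Z : Set X.left := ⋃ j, Set.range (g j).left with hZdef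
  have hZ : IsClosed Z := by
    rw [hZdef]
    exact isClosed_iUnion_of_finite fun j ↦ by
      haveI := hgproper j; exact (g j).left.isClosedMap.isClosed_range
  have hgoal : ∀ V : Set (ComplexPoints X),
      ({P : ComplexPoints X | P.pt ∈ ⋃ j, Set.range (g j).left.base} ⊆ V ↔
        ∀ P : ComplexPoints X, P.pt ∈ Z → P ∈ V) := fun V ↦ Iff.rfl
  -- it suffices that `x'` die on `Z(ℂ)`
  suffices hres : singularCohomology.map ℂ ℂ
      (⟨Subtype.val, continuous_subtype_val⟩ : C({P : ComplexPoints X // P.pt ∈ Z}, ComplexPoints X))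
      q x' = 0 by
    obtain ⟨V, hVo, hZV, hV⟩ := exists_isOpen_map_eq_zero_of_isClosed hX hZ x' hres
    exact ⟨V, hVo, (hgoal V).mpr hZV, hV⟩
  by_cases hZuniv : Z = Set.univ
  · -- `Z = X`: then `x' = 0`
    have h0 : complexBetti.map (𝟙 X) q x' = 0 :=
      complexBetti_map_eq_zero_of_range_subset_iUnion hX hX (𝟙 X) hY g
        (by rw [← hZdef, hZuniv]; exact Set.subset_univ _) x' hx'
    rw [complexBetti.map_id, ModuleCat.id_apply] at h0
    rw [h0, map_zero]
  -- `Z ⊊ X`: log resolution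
  obtain ⟨X', σ, k, D, hX', hbir, hiso, hDinj, hsmooth, hpre⟩ :=
    exists_logResolution_isSmoothProjective hX hZ hZuniv
  haveI := hiso
  haveI := hX'.smoothOfRelativeDimension
  haveI : IsProper X'.hom := hX'.isProjectiveOver.isProper
  obtain ⟨N, ιX', hιX'⟩ := hX'.isProjectiveOver
  haveI := hιX'
  set v : complexBetti X' q := complexBetti.map σ q x' with hv
  -- (3) `v` dies on every `V(D a)`
  haveI hsm : ∀ I : Finset (Fin k), SmoothOfRelativeDimension (n - I.card) (strataScheme D I).hom :=
    fun I ↦ hsmooth I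
  have hva : ∀ a : Fin k, complexBetti.map (strataHom D {a}) q v = 0 := by
    intro a
    rw [hv, ← ModuleCat.comp_apply, ← complexBetti.map_comp]
    refine complexBetti_map_eq_zero_of_smooth_closedSubscheme (dE := n - ({a} : Finset (Fin k)).card)
      hX' hX σ (strataHom D {a}) hY g ?_ x' hx'
    -- `σ(V(D a)) ⊆ Z`
    rintro _ ⟨t, rfl⟩
    change σ.left ((strataHom D {a}).left t) ∈ ⋃ j, Set.range (g j).left
    have ht : (strataHom D {a}).left t ∈ ((strataIdeal D {a}).support : Set X'.left) := by
      rw [strataHom_left, ← Scheme.IdealSheafData.range_subschemeι]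
      exact ⟨t, rfl⟩
    rw [strataIdeal_singleton] at ht
    have ht' : (strataHom D {a}).left t ∈ σ.left ⁻¹' Z := by
      rw [hpre]
      exact Set.mem_iUnion.mpr ⟨a, ht⟩
    exact ht'
  -- (4) `v` vanishes near `⋃ V(D a)(ℂ)`
  obtain ⟨V', -, hKV', hV'⟩ :=
    exists_isOpen_map_subsetIncl_eq_zero_of_strata (n := n) ιX' D (fun I ↦ n - I.card) v hva
  -- (5) transfer down `σ`
  set U : X.left.Opens := ⟨Zᶜ, hZ.isOpen_compl⟩ with hUdef
  have hvU : singularCohomology.map ℂ ℂ (⟨Subtype.val, continuous_subtype_val⟩ :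
      C({Q : ComplexPoints X' // (AlgPoints.map σ Q).pt ∉ U}, ComplexPoints X')) q
      (complexBetti.map σ q x') = 0 := by
    have hsub : {Q : ComplexPoints X' | (AlgPoints.map σ Q).pt ∉ U} ⊆ V' := by
      intro Q hQ
      refine hKV' ?_
      have hQ' : σ.left Q.pt ∈ Z := by
        have h : σ.left Q.pt ∉ (Zᶜ : Set X.left) := hQ
        by_contra hZm
        exact h hZm
      have hQ'' : Q.pt ∈ σ.left ⁻¹' Z := hQ'
      rw [hpre] at hQ''
      exact hQ''
    exact singularCohomology.map_subsetIncl_eq_zero_of_subset (R := ℂ) hsub v hV'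
  have hxU := singularCohomology_map_eq_zero_of_map_preimage_eq_zero_of_isIso_restrict hX' hX σ hbir
    U x' hvU
  -- `{P | P.pt ∈ Z} ⊆ {P | P.pt ∉ U}`
  exact singularCohomology.map_subsetIncl_eq_zero_of_subset (R := ℂ) (S := {P : ComplexPoints X | P.pt ∈ Z})
    (T := {P : ComplexPoints X | P.pt ∉ U}) (fun P hP ↦ fun h ↦ h hP) x' hxU

end Literature.AlgebraicGeometry.HodgeTheory
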